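import Summits.CriticalPhenomena.PercolationContinuityZ3.Theorems.PercGamblersRuinMinimalVoltage

/-!
# Route `PercGamblersRuin`, crux `VerticalGamblersRuin` (stmt-CriticalPhenomena-10642):
# stub `stub_minimalSolution` — the minimal solution of the slab Dirichlet problem

Helper file for the stub `stub_minimalSolution` of the line `registered` of the crux
`PercGamblersRuin.VerticalGamblersRuin` (stmt-CriticalPhenomena-10642).

For `A, T ∈ ℕ` with `T > 0` and a ceiling datum `g : Ω → ℤ³ → [0, 1]` with `ω ↦ g ω x` measurable
for every site `x`, there is a selection `w : Ω → ℤ³ → ℝ` such that for EVERY bond configuration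
`ω`: `w ω` is `[0, 1]`-valued, `w ω = g ω` on the ceiling region `{T ≤ x₀}`, `w ω = 0` on the floor
region `{x₀ ≤ -A}`, and `w ω` is harmonic for the open lattice edges of `ω` at every site of the
open slab `{-A < x₀ < T}`; moreover `ω ↦ w ω x` is measurable for EVERY site `x`, and `w ω` is
MINIMAL among nonnegative supersolutions: `w ω ≤ f` for every `f ≥ 0` with `g ω ≤ f` on the ceiling
region and `f` harmonic (for the open edges of `ω`) on the open slab.

Proof (Lyons–Peres, *Probability on Trees and Networks* (2016), §2.1: existence for the Dirichlet
problem by monotone iteration), adapted from `Theorems/PercGamblersRuinMinimalVoltage.lean` with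
the constant ceiling datum `1` replaced by `g ω`. Fix `ω`; the averaging operator is
`Φ f x = g ω x` if `x₀ ≥ T`, `= 0` if `x₀ ≤ -A`, and otherwise the mean of `f` over the open
neighbours of `x` (`= 0` if there are none, by `0 / 0 = 0`). Starting from `f₀ = g ω · 1_{x₀ ≥ T}`
the iterates `Φ^[k] f₀` are `[0, 1]`-valued and increase in `k` (`Φ` is monotone and
`f₀ ≤ Φ f₀`), so they converge to `w ω = ⨆ k, Φ^[k] f₀`; finite sums commute with the limit, so
`w ω = Φ (w ω)`, which is the two plate conditions plus harmonicity. Measurability of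
`ω ↦ (Φ_ω^[k] f₀) x`, for all sites `x` simultaneously, by induction on `k` (finite sums of
indicator-weighted measurable functions; the base case is the measurability of `g`), and then a
countable supremum. Minimality: if `f ≥ 0`, `f ≥ g ω` on the ceiling region and
`∑_{y ∼ x, open} (f y - f x) = 0` on the open slab, then `Φ f ≤ f` (on the slab `Φ f x` is the
open-neighbour mean of `f`, which equals `f x`, or is `0 ≤ f x` if `x` has no open neighbour), so
`Φ^[k] f₀ ≤ f` for every `k` by induction with the monotonicity of `Φ`, hence `w ω ≤ f`.

Design (as in the `MinimalVoltage` file): NO new definitions — the operator `Φ` enters the helper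
lemmas as a hypothesis `hΦ` giving its formula, the iterates are Mathlib's `Nat.iterate`, the
solution is the `iSup` of the iterates, and the stub theorem instantiates `Φ` by a lambda.

## References

* R. Lyons, Y. Peres, *Probability on Trees and Networks*, Cambridge University Press (2016),
  §2.1 (harmonic functions, the Dirichlet problem, existence and the maximum principle).
* G. Grimmett, *Percolation*, 2nd ed., Springer (1999), §1.3 (bond percolation vocabulary).
-/

noncomputable section

namespace Summit.CriticalPhenomena.PercolationContinuityZ3.Theorems.VerticalGamblersRuin

open MeasureTheory Filter Topology
open Literature.Probability.Percolation Literature.Probability.LatticeModels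
open scoped Classical

namespace StubMinimalSolution

/-! ### The abstract averaging iteration with a general first-plate datum `g` -/

-- adapted from Theorems/PercGamblersRuinMinimalVoltage.lean (`SlabVoltage.step_mono`, …,
-- `SlabVoltage.sum_sub_iSup_iterate_eq_zero`, `SlabVoltage.measurable_iterate`), datum `1 ↦ g`

section Abstract

variable {V : Type*} {N : V → Finset V} {p q : V → Prop} [DecidablePred p] [DecidablePred q]
  {g : V → ℝ} {Φ : (V → ℝ) → V → ℝ}

/-- The averaging operator with first-plate datum `g` is monotone. [folklore] -/
theorem step_mono
    (hΦ : ∀ f x, Φ f x = if p x then g x else if q x then 0 else (∑ y ∈ N x, f y) / ((N x).card : ℝ))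
    {f f' : V → ℝ} (hff' : ∀ x, f x ≤ f' x) (x : V) : Φ f x ≤ Φ f' x := by
  rw [hΦ, hΦ]
  split_ifs
  · exact le_rfl
  · exact le_rfl
  · exact div_le_div_of_nonneg_right (Finset.sum_le_sum fun y _ => hff' y) (Nat.cast_nonneg _)

/-- The averaging operator with a `[0, 1]`-valued datum preserves `[0, 1]`-valued functions.
[folklore] -/
theorem step_mem_Icc
    (hΦ : ∀ f x, Φ f x = if p x then g x else if q x then 0 else (∑ y ∈ N x, f y) / ((N x).card : ℝ))
    (hg : ∀ x, 0 ≤ g x ∧ g x ≤ 1) {f : V → ℝ} (hf : ∀ x, 0 ≤ f x ∧ f x ≤ 1) (x : V) :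
    0 ≤ Φ f x ∧ Φ f x ≤ 1 := by
  rw [hΦ]
  split_ifs
  · exact hg x
  · exact ⟨le_rfl, zero_le_one⟩
  · refine ⟨div_nonneg (Finset.sum_nonneg fun y _ => (hf y).1) (Nat.cast_nonneg _), ?_⟩
    refine div_le_one_of_le₀ ?_ (Nat.cast_nonneg _)
    calc ∑ y ∈ N x, f y ≤ ∑ _y ∈ N x, (1 : ℝ) := Finset.sum_le_sum fun y _ => (hf y).2
      _ = ((N x).card : ℝ) := by rw [Finset.sum_const, nsmul_eq_mul, mul_one]

/-- The iterates `Φ^[k] (g · 1_{p})` are `[0, 1]`-valued. [folklore] -/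
theorem iterate_mem_Icc
    (hΦ : ∀ f x, Φ f x = if p x then g x else if q x then 0 else (∑ y ∈ N x, f y) / ((N x).card : ℝ))
    (hg : ∀ x, 0 ≤ g x ∧ g x ≤ 1) (k : ℕ) (x : V) :
    0 ≤ (Φ^[k] fun z => if p z then g z else 0) x ∧ (Φ^[k] fun z => if p z then g z else 0) x ≤ 1 := by
  induction k generalizing x with
  | zero =>
    simp only [Function.iterate_zero, id_eq]
    split_ifs
    · exact hg x
    · exact ⟨le_rfl, zero_le_one⟩
  | succ k ih =>
    rw [Function.iterate_succ_apply']
    exact step_mem_Icc hΦ hg ih x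

/-- The iterates `Φ^[k] (g · 1_{p})` increase in `k` (`g · 1_{p} ≤ Φ (g · 1_{p})` and `Φ` is
monotone). [folklore] -/
theorem iterate_le_succ
    (hΦ : ∀ f x, Φ f x = if p x then g x else if q x then 0 else (∑ y ∈ N x, f y) / ((N x).card : ℝ))
    (hg : ∀ x, 0 ≤ g x ∧ g x ≤ 1) (k : ℕ) (x : V) :
    (Φ^[k] fun z => if p z then g z else 0) x ≤ (Φ^[k + 1] fun z => if p z then g z else 0) x := by
  induction k generalizing x with
  | zero =>
    rw [Function.iterate_succ_apply', Function.iterate_zero, id_eq, hΦ]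
    split_ifs
    · exact le_rfl
    · exact le_rfl
    · refine div_nonneg (Finset.sum_nonneg fun y _ => ?_) (Nat.cast_nonneg _)
      split_ifs
      · exact (hg y).1
      · exact le_rfl
  | succ k ih =>
    rw [Function.iterate_succ_apply', Function.iterate_succ_apply' (n := k + 1)]
    exact step_mono hΦ ih x

/-- The iterates converge to their supremum `⨆ k, (Φ^[k] (g · 1_{p})) x`. [folklore] -/
theorem tendsto_iterate
    (hΦ : ∀ f x, Φ f x = if p x then g x else if q x then 0 else (∑ y ∈ N x, f y) / ((N x).card : ℝ))
    (hg : ∀ x, 0 ≤ g x ∧ g x ≤ 1) (x : V) :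
    Tendsto (fun k => (Φ^[k] fun z => if p z then g z else 0) x) atTop
      (𝓝 (⨆ k, (Φ^[k] fun z => if p z then g z else 0) x)) :=
  tendsto_atTop_ciSup (monotone_nat_of_le_succ fun k => iterate_le_succ hΦ hg k x)
    ⟨1, by rintro _ ⟨k, rfl⟩; exact (iterate_mem_Icc hΦ hg k x).2⟩

/-- The limit is `[0, 1]`-valued. [folklore] -/
theorem iSup_iterate_mem_Icc
    (hΦ : ∀ f x, Φ f x = if p x then g x else if q x then 0 else (∑ y ∈ N x, f y) / ((N x).card : ℝ))
    (hg : ∀ x, 0 ≤ g x ∧ g x ≤ 1) (x : V) :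
    0 ≤ (⨆ k, (Φ^[k] fun z => if p z then g z else 0) x) ∧
      (⨆ k, (Φ^[k] fun z => if p z then g z else 0) x) ≤ 1 := by
  have hbdd : BddAbove (Set.range fun k => (Φ^[k] fun z => if p z then g z else 0) x) :=
    ⟨1, by rintro _ ⟨k, rfl⟩; exact (iterate_mem_Icc hΦ hg k x).2⟩
  exact ⟨(iterate_mem_Icc hΦ hg 0 x).1.trans (le_ciSup hbdd 0),
    ciSup_le fun k => (iterate_mem_Icc hΦ hg k x).2⟩

/-- On the first plate (`p x`) every iterate equals the datum `g x`. [folklore] -/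
theorem iterate_eq_datum
    (hΦ : ∀ f x, Φ f x = if p x then g x else if q x then 0 else (∑ y ∈ N x, f y) / ((N x).card : ℝ))
    {x : V} (hx : p x) (k : ℕ) : (Φ^[k] fun z => if p z then g z else 0) x = g x := by
  cases k with
  | zero => simp only [Function.iterate_zero, id_eq, if_pos hx]
  | succ k => rw [Function.iterate_succ_apply', hΦ, if_pos hx]

/-- On the first plate (`p x`) the limit equals the datum `g x`. [folklore] -/
theorem iSup_iterate_eq_datum
    (hΦ : ∀ f x, Φ f x = if p x then g x else if q x then 0 else (∑ y ∈ N x, f y) / ((N x).card : ℝ))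
    {x : V} (hx : p x) : (⨆ k, (Φ^[k] fun z => if p z then g z else 0) x) = g x := by
  simp only [iterate_eq_datum hΦ hx, ciSup_const]

/-- On the second plate (`q x`, off the first) every iterate equals `0`. [folklore] -/
theorem iterate_eq_zero
    (hΦ : ∀ f x, Φ f x = if p x then g x else if q x then 0 else (∑ y ∈ N x, f y) / ((N x).card : ℝ))
    {x : V} (hpx : ¬ p x) (hqx : q x) (k : ℕ) : (Φ^[k] fun z => if p z then g z else 0) x = 0 := by
  cases k with
  | zero => simp only [Function.iterate_zero, id_eq, if_neg hpx]
  | succ k => rw [Function.iterate_succ_apply', hΦ, if_neg hpx, if_pos hqx]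

/-- On the second plate (`q x`, off the first) the limit equals `0`. [folklore] -/
theorem iSup_iterate_eq_zero
    (hΦ : ∀ f x, Φ f x = if p x then g x else if q x then 0 else (∑ y ∈ N x, f y) / ((N x).card : ℝ))
    {x : V} (hpx : ¬ p x) (hqx : q x) : (⨆ k, (Φ^[k] fun z => if p z then g z else 0) x) = 0 := by
  simp only [iterate_eq_zero hΦ hpx hqx, ciSup_const]

/-- Off the plates the limit is the mean of its values over `N x` (finite sums commute with the
monotone limit): the fixed-point equation. [folklore] -/
theorem iSup_iterate_eq_avg
    (hΦ : ∀ f x, Φ f x = if p x then g x else if q x then 0 else (∑ y ∈ N x, f y) / ((N x).card : ℝ))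
    (hg : ∀ x, 0 ≤ g x ∧ g x ≤ 1) {x : V} (hpx : ¬ p x) (hqx : ¬ q x) :
    (⨆ k, (Φ^[k] fun z => if p z then g z else 0) x) =
      (∑ y ∈ N x, ⨆ k, (Φ^[k] fun z => if p z then g z else 0) y) / ((N x).card : ℝ) := by
  have h1 : Tendsto (fun k => (Φ^[k + 1] fun z => if p z then g z else 0) x) atTop
      (𝓝 (⨆ k, (Φ^[k] fun z => if p z then g z else 0) x)) :=
    (tendsto_iterate hΦ hg x).comp (tendsto_add_atTop_nat 1)
  have h2 : Tendsto (fun k => (Φ^[k + 1] fun z => if p z then g z else 0) x) atTop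
      (𝓝 ((∑ y ∈ N x, ⨆ k, (Φ^[k] fun z => if p z then g z else 0) y) / ((N x).card : ℝ))) := by
    have : (fun k => (Φ^[k + 1] fun z => if p z then g z else 0) x) =
        fun k => (∑ y ∈ N x, (Φ^[k] fun z => if p z then g z else 0) y) / ((N x).card : ℝ) := by
      funext k
      rw [Function.iterate_succ_apply', hΦ, if_neg hpx, if_neg hqx]
    rw [this]
    exact (tendsto_finsetSum _ fun y _ => tendsto_iterate hΦ hg y).div_const _
  exact tendsto_nhds_unique h1 h2

/-- Off the plates the limit is harmonic for the neighbourhoods `N x`: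
`∑_{y ∈ N x} (w y - w x) = 0`. [folklore] -/
theorem sum_sub_iSup_iterate_eq_zero
    (hΦ : ∀ f x, Φ f x = if p x then g x else if q x then 0 else (∑ y ∈ N x, f y) / ((N x).card : ℝ))
    (hg : ∀ x, 0 ≤ g x ∧ g x ≤ 1) {x : V} (hpx : ¬ p x) (hqx : ¬ q x) :
    ∑ y ∈ N x, ((⨆ k, (Φ^[k] fun z => if p z then g z else 0) y) -
      ⨆ k, (Φ^[k] fun z => if p z then g z else 0) x) = 0 := by
  rw [Finset.sum_sub_distrib, Finset.sum_const, nsmul_eq_mul]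
  rcases eq_or_ne ((N x).card : ℝ) 0 with hc | hc
  · have h0 : N x = ∅ := Finset.card_eq_zero.mp (by exact_mod_cast hc)
    simp [h0]
  · rw [iSup_iterate_eq_avg hΦ hg hpx hqx, mul_div_cancel₀ _ hc, sub_self]

/-- A nonnegative supersolution is a super-fixed-point: if `f ≥ 0`, `g ≤ f` on the first plate and
`∑_{y ∈ N x} (f y - f x) = 0` off the plates, then `Φ f ≤ f`. [folklore] -/
theorem step_le_of_supersolution
    (hΦ : ∀ f x, Φ f x = if p x then g x else if q x then 0 else (∑ y ∈ N x, f y) / ((N x).card : ℝ))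
    {f : V → ℝ} (hf0 : ∀ x, 0 ≤ f x) (hfp : ∀ x, p x → g x ≤ f x)
    (hfh : ∀ x, ¬ p x → ¬ q x → ∑ y ∈ N x, (f y - f x) = 0) (x : V) : Φ f x ≤ f x := by
  rw [hΦ]
  split_ifs with hpx hqx
  · exact hfp x hpx
  · exact hf0 x
  · have h := hfh x hpx hqx
    rw [Finset.sum_sub_distrib, Finset.sum_const, nsmul_eq_mul, sub_eq_zero] at h
    rw [h]
    rcases eq_or_ne ((N x).card : ℝ) 0 with hc | hc
    · rw [hc, zero_mul, zero_div]
      exact hf0 x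
    · rw [mul_div_cancel_left₀ _ hc]

/-- Minimality of the iterates: every iterate `Φ^[k] (g · 1_{p})` lies below every nonnegative
supersolution `f`. [folklore] -/
theorem iterate_le_of_supersolution
    (hΦ : ∀ f x, Φ f x = if p x then g x else if q x then 0 else (∑ y ∈ N x, f y) / ((N x).card : ℝ))
    {f : V → ℝ} (hf0 : ∀ x, 0 ≤ f x) (hfp : ∀ x, p x → g x ≤ f x)
    (hfh : ∀ x, ¬ p x → ¬ q x → ∑ y ∈ N x, (f y - f x) = 0) (k : ℕ) (x : V) :
    (Φ^[k] fun z => if p z then g z else 0) x ≤ f x := by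
  induction k generalizing x with
  | zero =>
    simp only [Function.iterate_zero, id_eq]
    split_ifs with hpx
    · exact hfp x hpx
    · exact hf0 x
  | succ k ih =>
    rw [Function.iterate_succ_apply']
    exact (step_mono hΦ ih x).trans (step_le_of_supersolution hΦ hf0 hfp hfh x)

/-- Minimality of the limit: `⨆ k, Φ^[k] (g · 1_{p}) ≤ f` for every nonnegative supersolution `f`.
[folklore] -/
theorem iSup_iterate_le_of_supersolution
    (hΦ : ∀ f x, Φ f x = if p x then g x else if q x then 0 else (∑ y ∈ N x, f y) / ((N x).card : ℝ))
    {f : V → ℝ} (hf0 : ∀ x, 0 ≤ f x) (hfp : ∀ x, p x → g x ≤ f x)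
    (hfh : ∀ x, ¬ p x → ¬ q x → ∑ y ∈ N x, (f y - f x) = 0) (x : V) :
    (⨆ k, (Φ^[k] fun z => if p z then g z else 0) x) ≤ f x :=
  ciSup_le fun k => iterate_le_of_supersolution hΦ hf0 hfp hfh k x

end Abstract

/-! ### The lattice part: measurability in the configuration at every site -/

/-- Measurability of the iterates in the configuration: `ω ↦ (Φ_ω^[k] (g ω · 1_{x₀ ≥ B})) x` is
measurable for the product σ-algebra, for every site `x` (induction on `k` simultaneously for all
sites: finite sums of indicator-weighted measurable functions; the base case is the measurability
of the datum `g`). [folklore] -/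
theorem measurable_iterate (A B : ℤ) {g : BondConfig (Site 3) → Site 3 → ℝ}
    (hgm : ∀ x, Measurable fun ω => g ω x)
    {Φ : BondConfig (Site 3) → (Site 3 → ℝ) → Site 3 → ℝ}
    (hΦ : ∀ ω f x, Φ ω f x = if B ≤ x 0 then g ω x else if x 0 ≤ -A then 0 else
      (∑ y ∈ ((zdGraph 3).neighborFinset x).filter (fun y => s(x, y) ∈ ω), f y) /
        ((((zdGraph 3).neighborFinset x).filter (fun y => s(x, y) ∈ ω)).card : ℝ))
    (k : ℕ) (x : Site 3) :
    Measurable fun ω => ((Φ ω)^[k] fun z => if B ≤ z 0 then g ω z else 0) x := by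
  induction k generalizing x with
  | zero =>
    simp only [Function.iterate_zero, id_eq]
    by_cases h1 : B ≤ x 0
    · simp only [if_pos h1]
      exact hgm x
    · simp only [if_neg h1]
      exact measurable_const
  | succ k ih =>
    simp only [Function.iterate_succ_apply', hΦ]
    by_cases h1 : B ≤ x 0
    · simp only [if_pos h1]
      exact hgm x
    · simp only [if_neg h1]
      by_cases h2 : x 0 ≤ -A
      · simp only [if_pos h2]
        exact measurable_const
      · simp only [if_neg h2]
        refine Measurable.div ?_ ?_
        · have : (fun ω : BondConfig (Site 3) =>
              ∑ y ∈ ((zdGraph 3).neighborFinset x).filter (fun y => s(x, y) ∈ ω),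
                ((Φ ω)^[k] fun z => if B ≤ z 0 then g ω z else 0) y) =
              fun ω => ∑ y ∈ (zdGraph 3).neighborFinset x,
                if s(x, y) ∈ ω then ((Φ ω)^[k] fun z => if B ≤ z 0 then g ω z else 0) y else 0 := by
            funext ω
            rw [Finset.sum_filter]
          rw [this]
          refine Finset.measurable_sum _ fun y _ => ?_
          exact Measurable.ite (measurableSet_mem (s(x, y) : Sym2 (Site 3))) (ih y) measurable_const
        · have : (fun ω : BondConfig (Site 3) =>
              ((((zdGraph 3).neighborFinset x).filter (fun y => s(x, y) ∈ ω)).card : ℝ)) =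
              fun ω => ∑ y ∈ (zdGraph 3).neighborFinset x, if s(x, y) ∈ ω then (1 : ℝ) else 0 := by
            funext ω
            rw [Finset.card_filter, Nat.cast_sum]
            refine Finset.sum_congr rfl fun y _ => ?_
            split_ifs <;> simp
          rw [this]
          refine Finset.measurable_sum _ fun y _ => ?_
          exact Measurable.ite (measurableSet_mem (s(x, y) : Sym2 (Site 3))) measurable_const
            measurable_const

end StubMinimalSolution

open StubMinimalSolution in
/-- **stub `stub_minimalSolution`** of the crux `VerticalGamblersRuin` (stmt-CriticalPhenomena-10642,
line `registered`; exact registered signature): the MINIMAL solution of the slab Dirichlet problem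
with a general measurable `[0, 1]`-valued ceiling datum. For `A, T ∈ ℕ`, `T > 0`, and
`g : Ω → ℤ³ → [0, 1]` with `ω ↦ g ω x` measurable for every `x`, there is `w : Ω → ℤ³ → ℝ` such that
for EVERY `ω`: `w ω` is `[0, 1]`-valued, equals `g ω` on `{T ≤ x₀}`, vanishes on `{x₀ ≤ -A}`, and is
harmonic for the open lattice edges of `ω` on the open slab `{-A < x₀ < T}`; `ω ↦ w ω x` is
measurable for EVERY site `x`; and `w ω ≤ f` for every nonnegative `f : ℤ³ → ℝ` that is `≥ g ω` on
`{T ≤ x₀}` and harmonic (for the open edges of `ω`) on the open slab. The witness is the monotone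
limit `w ω = ⨆ k, Φ_ω^[k] (g ω · 1_{x₀ ≥ T})` of the averaging iteration.
[cite: LyonsPeres2016, §2.1] -/
theorem stub_minimalSolution :
    ∀ (A T : ℕ), 0 < T → ∀ g : BondConfig (Site 3) → Site 3 → ℝ,
      (∀ x, Measurable fun ω => g ω x) → (∀ ω x, 0 ≤ g ω x ∧ g ω x ≤ 1) →
      ∃ w : BondConfig (Site 3) → Site 3 → ℝ,
        (∀ x, Measurable fun ω => w ω x) ∧
        (∀ ω, (∀ x, 0 ≤ w ω x ∧ w ω x ≤ 1) ∧
          (∀ x : Site 3, (T : ℤ) ≤ x 0 → w ω x = g ω x) ∧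
          (∀ x : Site 3, x 0 ≤ -(A : ℤ) → w ω x = 0) ∧
          ∀ x : Site 3, -(A : ℤ) < x 0 → x 0 < (T : ℤ) →
            ∑ y ∈ ((zdGraph 3).neighborFinset x).filter (fun y => s(x, y) ∈ ω), (w ω y - w ω x) = 0) ∧
        ∀ (ω : BondConfig (Site 3)) (f : Site 3 → ℝ), (∀ x, 0 ≤ f x) →
          (∀ x : Site 3, (T : ℤ) ≤ x 0 → g ω x ≤ f x) →
          (∀ x : Site 3, -(A : ℤ) < x 0 → x 0 < (T : ℤ) →
            ∑ y ∈ ((zdGraph 3).neighborFinset x).filter (fun y => s(x, y) ∈ ω), (f y - f x) = 0) →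
          ∀ x, w ω x ≤ f x := by
  intro A T hT g hgm hg
  -- the averaging operator of the configuration `ω` with ceiling datum `g ω`
  set Φ : BondConfig (Site 3) → (Site 3 → ℝ) → Site 3 → ℝ := fun ω f x =>
    if (T : ℤ) ≤ x 0 then g ω x else if x 0 ≤ -(A : ℤ) then 0 else
      (∑ y ∈ ((zdGraph 3).neighborFinset x).filter (fun y => s(x, y) ∈ ω), f y) /
        ((((zdGraph 3).neighborFinset x).filter (fun y => s(x, y) ∈ ω)).card : ℝ)
  have hΦ : ∀ ω f x, Φ ω f x = if (T : ℤ) ≤ x 0 then g ω x else if x 0 ≤ -(A : ℤ) then 0 else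
      (∑ y ∈ ((zdGraph 3).neighborFinset x).filter (fun y => s(x, y) ∈ ω), f y) /
        ((((zdGraph 3).neighborFinset x).filter (fun y => s(x, y) ∈ ω)).card : ℝ) :=
    fun ω f x => rfl
  refine ⟨fun ω x => ⨆ k, ((Φ ω)^[k] fun z => if (T : ℤ) ≤ z 0 then g ω z else 0) x, ?_, ?_, ?_⟩
  · -- measurability of `ω ↦ w ω x` at every site `x`
    intro x
    exact Measurable.iSup fun k => measurable_iterate (A : ℤ) (T : ℤ) hgm hΦ k x
  · -- for every `ω`: a `[0, 1]`-valued solution of the slab Dirichlet problem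
    intro ω
    refine ⟨?_, ?_, ?_, ?_⟩
    · -- values in `[0, 1]`
      intro x
      exact iSup_iterate_mem_Icc (p := fun z : Site 3 => (T : ℤ) ≤ z 0)
        (q := fun z : Site 3 => z 0 ≤ -(A : ℤ)) (g := g ω) (hΦ ω) (hg ω) x
    · -- ceiling datum
      intro x hx
      exact iSup_iterate_eq_datum (p := fun z : Site 3 => (T : ℤ) ≤ z 0)
        (q := fun z : Site 3 => z 0 ≤ -(A : ℤ)) (g := g ω) (hΦ ω) hx
    · -- floor
      intro x hx
      have hpx : ¬ (T : ℤ) ≤ x 0 := by omega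
      exact iSup_iterate_eq_zero (p := fun z : Site 3 => (T : ℤ) ≤ z 0)
        (q := fun z : Site 3 => z 0 ≤ -(A : ℤ)) (g := g ω) (hΦ ω) hpx hx
    · -- harmonic at the sites of the open slab
      intro x hlo hhi
      have hpx : ¬ (T : ℤ) ≤ x 0 := not_le.mpr hhi
      have hqx : ¬ x 0 ≤ -(A : ℤ) := not_le.mpr hlo
      exact sum_sub_iSup_iterate_eq_zero (p := fun z : Site 3 => (T : ℤ) ≤ z 0)
        (q := fun z : Site 3 => z 0 ≤ -(A : ℤ)) (g := g ω) (hΦ ω) (hg ω) hpx hqx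
  · -- minimality among nonnegative supersolutions
    intro ω f hf0 hfT hfh x
    refine iSup_iterate_le_of_supersolution (p := fun z : Site 3 => (T : ℤ) ≤ z 0)
      (q := fun z : Site 3 => z 0 ≤ -(A : ℤ)) (g := g ω) (hΦ ω) hf0 hfT ?_ x
    intro y hpy hqy
    exact hfh y (not_le.mp hqy) (not_le.mp hpy)

end Summit.CriticalPhenomena.PercolationContinuityZ3.Theorems.VerticalGamblersRuin

end
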